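import Summits.BirchSwinnertonDyer.BirchSwinnertonDyer.Theorems.AdditiveBranchIMCTwistFieldBaseChangePair
import Summits.BirchSwinnertonDyer.Rank1Residual.Additive.ChiBranchRatLowerDvdEnds
import Summits.BirchSwinnertonDyer.Rank1Residual.Additive.ChiBranchRatLowerDvdOddEnds
import HarnessLib

/-!
# Crux `GordTwoRankZeroOffCaseOne` (route `AdditiveBranchIMC`, item 19357), lane k1-c2x gen 2: the
# twist-field road in DESCENDED shape — Part 4: delivery to the b2b cell's NATIVE rational currency
# `ChiBranchRatLowerDvd[Odd]At W p` (row T-N10R, the located gap «one-sided rational Skinner–Urban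
# containment on the `ω^{(p−1)/2}` branch») and its X3♯/X4♯(G-ord) ends

Sequel of `…TwistFieldBaseChange` (Part 1) / `…TwistFieldBaseChangePair` (Part 2). Cell `bsd-addord`,
seat `bsd-addord-k1-c2x`. Route-independent (no `Theses` import). HONEST FRAMING: theorems only; every
published input is a DISPLAYED named-fact binder (Kato 2004 Thm. 17.4 `kato_divisibility`, clauses (1)(2)
only — NO image hypothesis; Rohrlich 1984 `padicLFunction_ne_zero`; Delbourgo 2002 Thm. (A)(B)
`Delbourgo2002.mainTheorem` for the torsion of `X(W/ℚ_∞)` at `p ≥ 5`, non-CM; for the ends Wuthrich 2014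
Thm. 16 / Kato's half-eigenspace reading, Pal 2012 Thm. 3.2, GZK, modularity); boundedness of the
Néron-normalised branch series is displayed (`MemIwasawaRat`, Mazur–Tate–Teitelbaum §I.12–I.13); the
descended product bound `GordTwistBaseChangeLower{Even,Odd}At W p` (this lane) and the b2b cell's
`ChiBranchRatLowerDvd[Odd]At W p` (n1011-p06) are typed CONJECTURES — nothing is asserted about either;
the unit coefficient is a displayed per-pair CERTIFICATE; nothing is booked; no label changes; BSD is not
proved by any of this.

## What

The b2b-bsdres cell (team n1011, `Additive/ChiBranchRatLowerDvd{,Odd}.lean`) typed the located gap of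
the (G-ord, `e = 2`) rank-`0` rows in Skinner–Urban's NATIVE currency: `ChiBranchRatLowerDvdAt W p` —
every `g ∈ char_Λ X(W/ℚ_∞)` has `p^m·g ∈ (G)`, `ι G = p^n·ϖ·L_p(f, α, ω^{(p−1)/2}, T)` — and landed ENDS:
on X4♯(G-ord) ∩ surj(p) and on X3♯(G-ord) (reducible `E[p]`, NO image hypothesis), `p ≥ 5`, non-CM,
non-anomalous, that input + ONE unit coefficient ⟹ the lower half and `BSD(E,p)`
(`ClassX{3,4}Gord.missingLowerBoundAt_rankZero_of_ratLowerDvd[Odd]_of_unitCoeff[_of_surj]`). This file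
proves that this lane's descended base-change input DELIVERS that currency:

* §7 **`chiBranchRatLowerDvdAt_of_baseChange`** / **`chiBranchRatLowerDvdOddAt_of_baseChangeOdd`** —
  (BC-Gord) + Kato (1)(2) + Rohrlich + torsion `hT` + boundedness ⟹ `ChiBranchRatLowerDvd[Odd]At W p`,
  at the pair, NO certificate, NO image hypothesis (Part 1 §2 + `p^{k+n}·g = h·G`).
* §8 **`…_of_delbourgo`** — the same with `hT` DISCHARGED by Delbourgo 2002 (A) (`p ≥ 5`, non-CM,
  `Addv ∧ TypeGOrd`).
* §9 ENDS by name: `ClassX3Gord.missingLowerBoundAt_rankZero_of_baseChange_of_unitCoeff` (REDUCIBLE rows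
  — the crux's off-Case-1 reducible rows included — `p ≡ 1 (mod 4)`, `p ≥ 5`),
  `ClassX4Gord.missingLowerBoundAt_rankZero_of_baseChange[Odd]_of_unitCoeff_of_surj` (both parities,
  `p ≥ 5`): the lower half from (BC-Gord) + ONE unit coefficient + the named facts, through n1011-p06's ends.
  So, modulo Kato (2) and Rohrlich, (BC-Gord) ⟹ T-N10R's typed gap, and (Part 2 §6) conversely up to
  the rational containment for `V`: the twist-field road and the b2b located gap are ONE missing theorem.

References: Skinner–Urban, Invent. Math. 195 (2014) Cor. 3.6.2/3.6.3 (p. 42), Thm. 3.6.4 (p. 43)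
[SkinnerUrban2014]; K. Kato, Astérisque 295 (2004) Thm. 17.4 [Kato2004Asterisque]; D. Rohrlich, Invent.
Math. 75 (1984) [RohrlichInventiones1984]; D. Delbourgo, J. Number Theory 95 (2002) Thm. (A)(B) (p. 40)
[Delbourgo2002]; C. Wuthrich, J. London Math. Soc. 90 (2014) Thm. 16 [Wuthrich2014]; V. Pal, Proc. AMS
140 (2012) Thm. 3.2 [Pal2012]; Mazur–Tate–Teitelbaum, Invent. Math. 84 (1986) §I.12–I.14
[MazurTateTeitelbaum1986Invent]; Burungale–Castella–Skinner, IMRN 2025 §5 (5.3) [BurungaleCastellaSkinner2025].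
-/

set_option autoImplicit false
set_option linter.dupNamespace false

noncomputable section

open scoped Classical MatrixGroups ModularForm

open CongruenceSubgroup WeierstrassCurve Literature.NumberTheory.EllipticCurves
  Literature.NumberTheory.EllipticCurves.ModularForms
  Literature.NumberTheory.EllipticCurves.Rank1Residual
  Literature.NumberTheory.EllipticCurves.Rank1Residual.Typed
  Literature.NumberTheory.GaloisRepresentations
  Literature.NumberTheory.EllipticCurves.GreenbergVatsal2000

namespace Summit.BirchSwinnertonDyer.BirchSwinnertonDyer.Theorems.AdditiveBranchIMCTwistField

open Summit.BirchSwinnertonDyer.Rank1Residual.Additive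

/-! ## §7 (BC-Gord) delivers the b2b cell's native rational currency `ChiBranchRatLowerDvd[Odd]At W p` -/

section RatCurrency

variable {W : WeierstrassCurve ℚ} {p : ℕ} [hp : Fact p.Prime]

/-- Bookkeeping: `p^k·ι g = ι h·B` and `p^n·B = ι G` give `p^{k+n}·g = h·G ∈ (G)`. [folklore] -/
theorem C_pow_mul_mem_span_of_C_pow_mul_eq {k n : ℕ} {g h G : IwasawaAlgebra p} {B : PowerSeries ℚ_[p]}
    (hk : PowerSeries.C ((p : ℚ_[p]) ^ k) * iwasawaToPowerSeries p g = iwasawaToPowerSeries p h * B)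
    (hG : PowerSeries.C ((p : ℚ_[p]) ^ n) * B = iwasawaToPowerSeries p G) :
    PowerSeries.C ((p : ℤ_[p]) ^ (k + n)) * g ∈ Ideal.span {G} := by
  refine Ideal.mem_span_singleton'.mpr ⟨h, iwasawaToPowerSeries_injective p ?_⟩
  rw [map_mul, map_mul, iwasawaToPowerSeries_C_natCast_pow p, ← hG, pow_add, map_mul]
  linear_combination (-(PowerSeries.C ((p : ℚ_[p]) ^ n))) * hk

/-- **`ChiBranchRatLowerDvdAt W p` (b2b row T-N10R's typed located gap: the ONE-SIDED RATIONAL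
Skinner–Urban containment on the even branch) from the descended twist-field input**, at the pair, with NO
certificate and NO image hypothesis: (BC-Gord, even) + Kato 17.4 (1)(2) for the twist models
(`kato_divisibility`, rational clause) + Rohrlich (`padicLFunction_ne_zero`) + torsion of `X(W/ℚ_∞)`
(`hT`) + boundedness of `ϖ·L_p(f, α, ω^{(p−1)/2}, T)` (`hbdd`, Mazur–Tate–Teitelbaum §I.12).
[cite: SkinnerUrban2014, Cor. 3.6.2 (p. 42) (shape)] [cite: Kato2004Asterisque, Thm. 17.4 (1)(2) (p. 273)]
[cite: RohrlichInventiones1984, Theorem (p. 409)] [cite: MazurTateTeitelbaum1986Invent, §I.12–I.13] -/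
theorem chiBranchRatLowerDvdAt_of_baseChange
    (hkato : ∀ (V : WeierstrassCurve ℚ) [V.IsElliptic] [V.IsGloballyMinimal] (κ : ZpExtension ℚ p)
      (γ : Field.absoluteGaloisGroup ℚ) (N : ℕ) [NeZero N] (f : CuspForm (Gamma0 N) 2),
      kato_divisibility V p (κ := κ) (γ := γ) (f := f))
    (hR : ∀ (V : WeierstrassCurve ℚ) [V.IsElliptic] [V.IsGloballyMinimal] (N : ℕ) [NeZero N]
      (f : CuspForm (Gamma0 N) 2), padicLFunction_ne_zero (W := V) (p := p) (f := f))
    (hT : ∀ (κ : ZpExtension ℚ p) (γ : Field.absoluteGaloisGroup ℚ) (D : W.SelmerDualData κ γ),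
      κ.IsCyclotomic → κ.IsTopGenerator γ → D.IsTorsion)
    (hbdd : ∀ (V : WeierstrassCurve ℚ) [V.IsElliptic] [V.IsGloballyMinimal] {N : ℕ} [NeZero N]
      (f : CuspForm (Gamma0 N) 2) (ϖ : ℚ), (∃ C : VariableChange ℚ, C • V.quadraticTwist (p : ℚ) = W) →
      GoodOrd V p → IsNewformOf V f → (ϖ : ℝ) * V.realPeriodRat = plusPeriod f →
      MemIwasawaRat p
        (PowerSeries.C ((ϖ : ℚ) : ℚ_[p]) * padicLFunctionBranch f (unitRoot V p : ℚ_[p]) (p / 2)))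
    (hBC : GordTwistBaseChangeLowerEvenAt W p) :
    ChiBranchRatLowerDvdAt W p := by
  intro V _ _ κ γ N _ f hp1 hCW hV hκ hγ hγ' hf D ϖ hϖ g hg
  have hp2 : p ≠ 2 := by rintro rfl; norm_num at hp1
  obtain ⟨n, G, hG⟩ := hbdd V f ϖ hCW hV hf hϖ
  obtain ⟨C, hCW'⟩ := hCW
  let DV : V.SelmerDualData κ γ := V.selmerDualData κ hγ
  obtain ⟨hVt, hKV, -⟩ := hkato V κ γ N f hp2 hV hκ hγ hγ' hf DV
  obtain ⟨k, h, hk⟩ := exists_C_pow_mul_eq_mul_branch_of_baseChange hBC V hV hCW' hf hκ hγ hγ' DV hVt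
    hKV (hR V N f hV hf) D (hT κ γ D hκ hγ) ϖ hϖ g hg
  exact ⟨G, k + n, n, C_pow_mul_mem_span_of_C_pow_mul_eq hk hG, hG.symm⟩

/-- **`ChiBranchRatLowerDvdOddAt W p` from the descended twist-field input** — odd twin
(`p ≡ 3 (mod 4)`, `p = 3` included; minus symbols, `ϖ⁻·|Ω⁻(V)| = Ω⁻_f`).
[cite: SkinnerUrban2014, Cor. 3.6.2 (p. 42) (shape)] [cite: Kato2004Asterisque, Thm. 17.4 (1)(2) (p. 273)]
[cite: RohrlichInventiones1984, Theorem (p. 409)] [cite: MazurTateTeitelbaum1986Invent, §I.12–I.13] -/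
theorem chiBranchRatLowerDvdOddAt_of_baseChangeOdd
    (hkato : ∀ (V : WeierstrassCurve ℚ) [V.IsElliptic] [V.IsGloballyMinimal] (κ : ZpExtension ℚ p)
      (γ : Field.absoluteGaloisGroup ℚ) (N : ℕ) [NeZero N] (f : CuspForm (Gamma0 N) 2),
      kato_divisibility V p (κ := κ) (γ := γ) (f := f))
    (hR : ∀ (V : WeierstrassCurve ℚ) [V.IsElliptic] [V.IsGloballyMinimal] (N : ℕ) [NeZero N]
      (f : CuspForm (Gamma0 N) 2), padicLFunction_ne_zero (W := V) (p := p) (f := f))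
    (hT : ∀ (κ : ZpExtension ℚ p) (γ : Field.absoluteGaloisGroup ℚ) (D : W.SelmerDualData κ γ),
      κ.IsCyclotomic → κ.IsTopGenerator γ → D.IsTorsion)
    (hbdd : ∀ (V : WeierstrassCurve ℚ) [V.IsElliptic] [V.IsGloballyMinimal] {N : ℕ} [NeZero N]
      (f : CuspForm (Gamma0 N) 2) (ϖ : ℚ),
      (∃ C : VariableChange ℚ, C • V.quadraticTwist (-(p : ℚ)) = W) →
      GoodOrd V p → IsNewformOf V f → (ϖ : ℝ) * V.imaginaryPeriodRat = minusPeriod f →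
      MemIwasawaRat p
        (PowerSeries.C ((ϖ : ℚ) : ℚ_[p]) * padicLFunctionMinusBranch f (unitRoot V p : ℚ_[p]) (p / 2)))
    (hBC : GordTwistBaseChangeLowerOddAt W p) :
    ChiBranchRatLowerDvdOddAt W p := by
  intro V _ _ κ γ N _ f hp3 hCW hV hκ hγ hγ' hf D ϖ hϖ g hg
  have hp2 : p ≠ 2 := by rintro rfl; norm_num at hp3
  obtain ⟨n, G, hG⟩ := hbdd V f ϖ hCW hV hf hϖ
  obtain ⟨C, hCW'⟩ := hCW
  let DV : V.SelmerDualData κ γ := V.selmerDualData κ hγ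
  obtain ⟨hVt, hKV, -⟩ := hkato V κ γ N f hp2 hV hκ hγ hγ' hf DV
  obtain ⟨k, h, hk⟩ := exists_C_pow_mul_eq_mul_minusBranch_of_baseChangeOdd hBC V hV hCW' hf hκ hγ hγ'
    DV hVt hKV (hR V N f hV hf) D (hT κ γ D hκ hγ) ϖ hϖ g hg
  exact ⟨G, k + n, n, C_pow_mul_mem_span_of_C_pow_mul_eq hk hG, hG.symm⟩

end RatCurrency

/-! ## §8 The torsion binder discharged by Delbourgo 2002 (A) at `p ≥ 5`, non-CM -/

section Delbourgo

variable {W : WeierstrassCurve ℚ} [W.IsElliptic] [W.IsGloballyMinimal] {p : ℕ} [hp : Fact p.Prime]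

/-- **`ChiBranchRatLowerDvdAt W p` from (BC-Gord) on the (G)-ordinary additive locus at `p ≥ 5`, non-CM**,
with the torsion of `X(W/ℚ_∞)` supplied by Delbourgo 2002 Thm. (A) (`Delbourgo2002.mainTheorem`,
hypothesis (G) = `TypeGOrd W p`). NO image hypothesis, NO certificate.
[cite: Delbourgo2002, Theorem (A) (p. 40)] [cite: Kato2004Asterisque, Thm. 17.4 (1)(2) (p. 273)]
[cite: RohrlichInventiones1984, Theorem (p. 409)] -/
theorem chiBranchRatLowerDvdAt_of_baseChange_of_delbourgo
    (hkato : ∀ (V : WeierstrassCurve ℚ) [V.IsElliptic] [V.IsGloballyMinimal] (κ : ZpExtension ℚ p)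
      (γ : Field.absoluteGaloisGroup ℚ) (N : ℕ) [NeZero N] (f : CuspForm (Gamma0 N) 2),
      kato_divisibility V p (κ := κ) (γ := γ) (f := f))
    (hR : ∀ (V : WeierstrassCurve ℚ) [V.IsElliptic] [V.IsGloballyMinimal] (N : ℕ) [NeZero N]
      (f : CuspForm (Gamma0 N) 2), padicLFunction_ne_zero (W := V) (p := p) (f := f))
    (hbdd : ∀ (V : WeierstrassCurve ℚ) [V.IsElliptic] [V.IsGloballyMinimal] {N : ℕ} [NeZero N]
      (f : CuspForm (Gamma0 N) 2) (ϖ : ℚ), (∃ C : VariableChange ℚ, C • V.quadraticTwist (p : ℚ) = W) →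
      GoodOrd V p → IsNewformOf V f → (ϖ : ℝ) * V.realPeriodRat = plusPeriod f →
      MemIwasawaRat p
        (PowerSeries.C ((ϖ : ℚ) : ℚ_[p]) * padicLFunctionBranch f (unitRoot V p : ℚ_[p]) (p / 2)))
    (hDel : Delbourgo2002.mainTheorem) (hp5 : 5 ≤ p) (hcm : ¬ W.HasCM) (hadd : Addv W p)
    (hG : TypeGOrd W p) (hBC : GordTwistBaseChangeLowerEvenAt W p) :
    ChiBranchRatLowerDvdAt W p :=
  chiBranchRatLowerDvdAt_of_baseChange hkato hR
    (fun _ _ D hκ hγ ↦ Delbourgo2002.mainTheorem.isTorsion hDel hp5 hcm hadd hG hκ hγ D) hbdd hBC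

/-- **`ChiBranchRatLowerDvdOddAt W p` from (BC-Gord, odd) at `p ≥ 5` (so `p ≥ 7`), non-CM**, torsion
by Delbourgo 2002 (A). [cite: Delbourgo2002, Theorem (A) (p. 40)]
[cite: Kato2004Asterisque, Thm. 17.4 (1)(2) (p. 273)] [cite: RohrlichInventiones1984, Theorem (p. 409)] -/
theorem chiBranchRatLowerDvdOddAt_of_baseChangeOdd_of_delbourgo
    (hkato : ∀ (V : WeierstrassCurve ℚ) [V.IsElliptic] [V.IsGloballyMinimal] (κ : ZpExtension ℚ p)
      (γ : Field.absoluteGaloisGroup ℚ) (N : ℕ) [NeZero N] (f : CuspForm (Gamma0 N) 2),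
      kato_divisibility V p (κ := κ) (γ := γ) (f := f))
    (hR : ∀ (V : WeierstrassCurve ℚ) [V.IsElliptic] [V.IsGloballyMinimal] (N : ℕ) [NeZero N]
      (f : CuspForm (Gamma0 N) 2), padicLFunction_ne_zero (W := V) (p := p) (f := f))
    (hbdd : ∀ (V : WeierstrassCurve ℚ) [V.IsElliptic] [V.IsGloballyMinimal] {N : ℕ} [NeZero N]
      (f : CuspForm (Gamma0 N) 2) (ϖ : ℚ),
      (∃ C : VariableChange ℚ, C • V.quadraticTwist (-(p : ℚ)) = W) →
      GoodOrd V p → IsNewformOf V f → (ϖ : ℝ) * V.imaginaryPeriodRat = minusPeriod f →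
      MemIwasawaRat p
        (PowerSeries.C ((ϖ : ℚ) : ℚ_[p]) * padicLFunctionMinusBranch f (unitRoot V p : ℚ_[p]) (p / 2)))
    (hDel : Delbourgo2002.mainTheorem) (hp5 : 5 ≤ p) (hcm : ¬ W.HasCM) (hadd : Addv W p)
    (hG : TypeGOrd W p) (hBC : GordTwistBaseChangeLowerOddAt W p) :
    ChiBranchRatLowerDvdOddAt W p :=
  chiBranchRatLowerDvdOddAt_of_baseChangeOdd hkato hR
    (fun _ _ D hκ hγ ↦ Delbourgo2002.mainTheorem.isTorsion hDel hp5 hcm hadd hG hκ hγ D) hbdd hBC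

end Delbourgo

/-! ## §9 ENDS by name on X3♯(G-ord) and X4♯(G-ord) ∩ surj, through n1011-p06's ends -/

section Ends

variable {W : WeierstrassCurve ℚ} [W.IsElliptic] [W.IsGloballyMinimal] {p : ℕ} [hp : Fact p.Prime]

/-- **X3♯(G-ord) ∩ `I₀*` (REDUCIBLE `E[p]` — the crux's off-Case-1 reducible rows included), `p ≥ 5`,
`p ≡ 1 (mod 4)`, non-CM, non-anomalous, `r_an = 0`: the LOWER half `ord_p #Ш_an ≤ ord_p #Ш` ⟸ the
descended base-change input `GordTwistBaseChangeLowerEvenAt W p` (OPEN) + ONE unit coefficient** — and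
the named facts (Wuthrich Thm. 16 `hWu`, Delbourgo 2002 `hDel`, Pal `hPal`, GZK, modularity, Kato (1)(2)
`hkato`, Rohrlich `hR`, boundedness `hbdd`); NO image hypothesis anywhere. §8 ∘ n1011-p06's
`ClassX3Gord.missingLowerBoundAt_rankZero_of_ratLowerDvd_of_unitCoeff`. Nothing booked.
[cite: Wuthrich2014, Thm. 16 (p. 397)] [cite: Delbourgo2002, Theorem (A), (B) (p. 40)]
[cite: Pal2012, Thm. 3.2] [cite: Kato2004Asterisque, Thm. 17.4 (1)(2) (p. 273)] [cite: Miller2011LMS, Def. 1.1] -/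
theorem ClassX3Gord.missingLowerBoundAt_rankZero_of_baseChange_of_unitCoeff
    (hWu : Wuthrich2014.thm16_halfEigenCharIdeal_dvd_cyclotomicPrime)
    (hDel : Delbourgo2002.mainTheorem)
    (hPal : Pal2012.thm32_sqrt_mul_realPeriodRat_twist_eq_of_prime_one_mod_four)
    (hGZK : rank_eq_analyticRank_of_analyticRank_le_one) (hmod : hasEntireLFunction_rat)
    (hmodD : nonempty_modularParametrizationData)
    (hkato : ∀ (V : WeierstrassCurve ℚ) [V.IsElliptic] [V.IsGloballyMinimal] (κ : ZpExtension ℚ p)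
      (γ : Field.absoluteGaloisGroup ℚ) (N : ℕ) [NeZero N] (f : CuspForm (Gamma0 N) 2),
      kato_divisibility V p (κ := κ) (γ := γ) (f := f))
    (hR : ∀ (V : WeierstrassCurve ℚ) [V.IsElliptic] [V.IsGloballyMinimal] (N : ℕ) [NeZero N]
      (f : CuspForm (Gamma0 N) 2), padicLFunction_ne_zero (W := V) (p := p) (f := f))
    (hbdd : ∀ (V : WeierstrassCurve ℚ) [V.IsElliptic] [V.IsGloballyMinimal] {N : ℕ} [NeZero N]
      (f : CuspForm (Gamma0 N) 2) (ϖ : ℚ), (∃ C : VariableChange ℚ, C • V.quadraticTwist (p : ℚ) = W) →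
      GoodOrd V p → IsNewformOf V f → (ϖ : ℝ) * V.realPeriodRat = plusPeriod f →
      MemIwasawaRat p
        (PowerSeries.C ((ϖ : ℚ) : ℚ_[p]) * padicLFunctionBranch f (unitRoot V p : ℚ_[p]) (p / 2)))
    (hX : ClassX3Gord W p) (he : semistabilityIndex W p = 2) (hp5 : 5 ≤ p) (hp4 : p % 4 = 1)
    (hcm : ¬ W.HasCM) (hr : W.analyticRank = 0) (hna : Delbourgo2002.ReductionNonAnomalous W p)
    (hBC : GordTwistBaseChangeLowerEvenAt W p)
    (hcert : ∀ (V : WeierstrassCurve ℚ) [V.IsElliptic] [V.IsGloballyMinimal] (C : VariableChange ℚ),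
      GoodOrd V p → C • V.quadraticTwist (p : ℚ) = W →
      ∀ {N : ℕ} [NeZero N] (f : CuspForm (Gamma0 N) 2), IsNewformOf V f →
      ∀ ϖ : ℚ, (ϖ : ℝ) * V.realPeriodRat = plusPeriod f →
      ∃ n : ℕ, ‖PowerSeries.coeff n
        (PowerSeries.C (ϖ : ℚ_[p]) * padicLFunctionBranch f (unitRoot V p : ℚ_[p]) (p / 2))‖ = 1) :
    MissingLowerBoundAt W p :=
  hX.missingLowerBoundAt_rankZero_of_ratLowerDvd_of_unitCoeff hWu hDel hPal hGZK hmod hmodD he hp5 hp4 hcm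
    hr hna (chiBranchRatLowerDvdAt_of_baseChange_of_delbourgo hkato hR hbdd hDel hp5 hcm hX.addv
      hX.typeGOrd hBC) hcert

/-- **X4♯(G-ord) ∩ `I₀*` ∩ surj(p) ∩ non-anomalous, `p ≥ 5`, `p ≡ 1 (mod 4)`, non-CM, `r_an = 0`: the
LOWER half ⟸ `GordTwistBaseChangeLowerEvenAt W p` (OPEN) + ONE unit coefficient** (+ Kato's
half-eigenspace reading `hKW`, Delbourgo 2002, Pal, GZK, modularity, Kato (1)(2), Rohrlich, boundedness).
§8 ∘ n1011-p06's `ClassX4Gord.missingLowerBoundAt_rankZero_of_ratLowerDvd_of_unitCoeff_of_surj`.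
Nothing booked. [cite: Kato2004Asterisque, Thm. 17.4 (p. 273)] [cite: Delbourgo2002, Theorem (A), (B) (p. 40)]
[cite: Pal2012, Thm. 3.2] [cite: Miller2011LMS, Def. 1.1] -/
theorem ClassX4Gord.missingLowerBoundAt_rankZero_of_baseChange_of_unitCoeff_of_surj
    (hKW : Wuthrich2014.kato_halfEigenCharIdeal_dvd_cyclotomicPrime_of_surjective)
    (hDel : Delbourgo2002.mainTheorem)
    (hPal : Pal2012.thm32_sqrt_mul_realPeriodRat_twist_eq_of_prime_one_mod_four)
    (hGZK : rank_eq_analyticRank_of_analyticRank_le_one) (hmod : hasEntireLFunction_rat)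
    (hmodD : nonempty_modularParametrizationData)
    (hkato : ∀ (V : WeierstrassCurve ℚ) [V.IsElliptic] [V.IsGloballyMinimal] (κ : ZpExtension ℚ p)
      (γ : Field.absoluteGaloisGroup ℚ) (N : ℕ) [NeZero N] (f : CuspForm (Gamma0 N) 2),
      kato_divisibility V p (κ := κ) (γ := γ) (f := f))
    (hR : ∀ (V : WeierstrassCurve ℚ) [V.IsElliptic] [V.IsGloballyMinimal] (N : ℕ) [NeZero N]
      (f : CuspForm (Gamma0 N) 2), padicLFunction_ne_zero (W := V) (p := p) (f := f))
    (hbdd : ∀ (V : WeierstrassCurve ℚ) [V.IsElliptic] [V.IsGloballyMinimal] {N : ℕ} [NeZero N]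
      (f : CuspForm (Gamma0 N) 2) (ϖ : ℚ), (∃ C : VariableChange ℚ, C • V.quadraticTwist (p : ℚ) = W) →
      GoodOrd V p → IsNewformOf V f → (ϖ : ℝ) * V.realPeriodRat = plusPeriod f →
      MemIwasawaRat p
        (PowerSeries.C ((ϖ : ℚ) : ℚ_[p]) * padicLFunctionBranch f (unitRoot V p : ℚ_[p]) (p / 2)))
    (hX : ClassX4Gord W p) (he : semistabilityIndex W p = 2) (hp5 : 5 ≤ p) (hp4 : p % 4 = 1)
    (hcm : ¬ W.HasCM) (hr : W.analyticRank = 0) (hna : Delbourgo2002.ReductionNonAnomalous W p)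
    (hsurj : Surj W p) (hBC : GordTwistBaseChangeLowerEvenAt W p)
    (hcert : ∀ (V : WeierstrassCurve ℚ) [V.IsElliptic] [V.IsGloballyMinimal] (C : VariableChange ℚ),
      GoodOrd V p → C • V.quadraticTwist (p : ℚ) = W →
      ∀ {N : ℕ} [NeZero N] (f : CuspForm (Gamma0 N) 2), IsNewformOf V f →
      ∀ ϖ : ℚ, (ϖ : ℝ) * V.realPeriodRat = plusPeriod f →
      ∃ n : ℕ, ‖PowerSeries.coeff n
        (PowerSeries.C (ϖ : ℚ_[p]) * padicLFunctionBranch f (unitRoot V p : ℚ_[p]) (p / 2))‖ = 1) :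
    MissingLowerBoundAt W p :=
  hX.missingLowerBoundAt_rankZero_of_ratLowerDvd_of_unitCoeff_of_surj hKW hDel hPal hGZK hmod hmodD he hp5
    hp4 hcm hr hna hsurj (chiBranchRatLowerDvdAt_of_baseChange_of_delbourgo hkato hR hbdd hDel hp5 hcm
      hX.addv.2 hX.typeGOrd hBC) hcert

/-- **X4♯(G-ord) ∩ `I₀*` ∩ surj(p) ∩ non-anomalous, `p ≡ 3 (mod 4)`, `p ≥ 5` (so `p ≥ 7`), non-CM,
`r_an = 0`: the LOWER half ⟸ `GordTwistBaseChangeLowerOddAt W p` (OPEN) + ONE unit coefficient** — odd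
twin, §8 ∘ n1011-p06's `ClassX4Gord.missingLowerBoundAt_rankZero_of_ratLowerDvdOdd_of_unitCoeff_of_surj`.
Nothing booked. [cite: Kato2004Asterisque, Thm. 17.4 (p. 273)] [cite: Delbourgo2002, Theorem (A), (B) (p. 40)]
[cite: Miller2011LMS, Def. 1.1] -/
theorem ClassX4Gord.missingLowerBoundAt_rankZero_of_baseChangeOdd_of_unitCoeff_of_surj
    (hKW : Wuthrich2014.kato_halfEigenCharIdeal_dvd_cyclotomicPrime_of_surjective)
    (hDel : Delbourgo2002.mainTheorem)
    (hGZK : rank_eq_analyticRank_of_analyticRank_le_one) (hmod : hasEntireLFunction_rat)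
    (hmodD : nonempty_modularParametrizationData)
    (hkato : ∀ (V : WeierstrassCurve ℚ) [V.IsElliptic] [V.IsGloballyMinimal] (κ : ZpExtension ℚ p)
      (γ : Field.absoluteGaloisGroup ℚ) (N : ℕ) [NeZero N] (f : CuspForm (Gamma0 N) 2),
      kato_divisibility V p (κ := κ) (γ := γ) (f := f))
    (hR : ∀ (V : WeierstrassCurve ℚ) [V.IsElliptic] [V.IsGloballyMinimal] (N : ℕ) [NeZero N]
      (f : CuspForm (Gamma0 N) 2), padicLFunction_ne_zero (W := V) (p := p) (f := f))
    (hbdd : ∀ (V : WeierstrassCurve ℚ) [V.IsElliptic] [V.IsGloballyMinimal] {N : ℕ} [NeZero N]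
      (f : CuspForm (Gamma0 N) 2) (ϖ : ℚ),
      (∃ C : VariableChange ℚ, C • V.quadraticTwist (-(p : ℚ)) = W) →
      GoodOrd V p → IsNewformOf V f → (ϖ : ℝ) * V.imaginaryPeriodRat = minusPeriod f →
      MemIwasawaRat p
        (PowerSeries.C ((ϖ : ℚ) : ℚ_[p]) * padicLFunctionMinusBranch f (unitRoot V p : ℚ_[p]) (p / 2)))
    (hX : ClassX4Gord W p) (he : semistabilityIndex W p = 2) (hp5 : 5 ≤ p) (hp4 : p % 4 = 3)
    (hcm : ¬ W.HasCM) (hr : W.analyticRank = 0) (hna : Delbourgo2002.ReductionNonAnomalous W p)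
    (hsurj : Surj W p) (hBC : GordTwistBaseChangeLowerOddAt W p)
    (hcert : ∀ (V : WeierstrassCurve ℚ) [V.IsElliptic] [V.IsGloballyMinimal] (C : VariableChange ℚ),
      GoodOrd V p → C • V.quadraticTwist (-(p : ℚ)) = W →
      ∀ {N : ℕ} [NeZero N] (f : CuspForm (Gamma0 N) 2), IsNewformOf V f →
      ∀ ϖ : ℚ, (ϖ : ℝ) * V.imaginaryPeriodRat = minusPeriod f →
      ∃ n : ℕ, ‖PowerSeries.coeff n
        (PowerSeries.C (ϖ : ℚ_[p]) * padicLFunctionMinusBranch f (unitRoot V p : ℚ_[p]) (p / 2))‖ = 1) :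
    MissingLowerBoundAt W p :=
  hX.missingLowerBoundAt_rankZero_of_ratLowerDvdOdd_of_unitCoeff_of_surj hKW hDel hGZK hmod hmodD he hp5
    hp4 hcm hr hna hsurj (chiBranchRatLowerDvdOddAt_of_baseChangeOdd_of_delbourgo hkato hR hbdd hDel hp5
      hcm hX.addv.2 hX.typeGOrd hBC) hcert

end Ends

end Summit.BirchSwinnertonDyer.BirchSwinnertonDyer.Theorems.AdditiveBranchIMCTwistField

end
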